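import Literature.Probability.FitznerVanDerHofstad2017.NobleBoundingEvents
import HarnessLib

/-!
# [FvdH17] §4.4, the product bound (4.65): the one-level engine and the case `N = 1`, PROVED

Source: R. Fitzner, R. van der Hofstad, *Mean-field behavior for nearest-neighbor percolation in `d > 10`*,
Electron. J. Probab. **22** (2017) no. 43 [FvdH17], §4.4, display (4.65) [TeX label `XiFs`]
(arXiv:1506.07977v2 p. 43 = EJP p. 40; equation numbers agree in both versions):

  "We conclude from (4.63) and (4.64) that
  `Ξ^{(N)}_p(x) ≤ Σ_{t⃗,w⃗,z⃗,b⃗} p^N P_p(F₀(b₀,w₀,z₁) ∩ {b̄₀ ∉ C̃₀})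
      × Π_{i=1}^{N-1} P_p^{b̲_{i-1}}(F_i(b_{i-1},t_i,z_i,b_i,w_i,z_{i+1}) ∩ {b̄_i ∉ C̃_i}) P_p^{b̲_{N-1}}(F_N(b_{N-1},t_N,z_N,x)),`
  where the summation is over `t⃗ = (t_0,…,t_N)`, `w⃗ = (w_0,…,w_{N-1})`, `z⃗ = (z_1,…,z_N)` and `b⃗ = (b_0,…,b_{N-1})`.
  The probabilities in (4.65) factor as the events `F_0,…,F_N` occur on different percolation configurations and
  are thus independent."

In the tree `Ξ^{(N)}` is the nested expectation `nobleXiT d p N x = 𝒩^{∅,∅}(𝒩^{N-1} nobleKerXi)({0},0,x)`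
(`LaceExpansionNobleCoefficients`: `nobleOp`, `nobleIter`, `nobleKerXi`), in which the independence of the levels
is built in (each level is integrated against its own copy of `P_p`).  This module proves

* the ONE-LEVEL ENGINE `nobleOp_le_tsum_of_kernel_le`: if the inner kernel is bounded linearly in the indicator
  of its set argument, `h(u)(A″,v′,x) ≤ Σ_z 𝟙_{A″}(z) G((u,v′),z)` for `u ≠ v′`, then
  `(𝒩^{B,A′} h)(A,v,x) ≤ Σ_{b} Σ_z J(b) · P_p(nobleCell ∩ {z ∈ C̃^{b}(v)(ω_{Bᶜ}) ∪ A′}) · G(b,z)` — the step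
  "pull `𝟙{z_{i+1} ∈ C̃_i}` into level `i`" of the printed argument (Tonelli);
* (4.65) for `N = 1`, `nobleXiT_one_le`:
  `Ξ^{(1)}(x) ≤ Σ_{b₀,z₁,t₁,w₀} J(b₀) P_p(F₀(b₀,w₀,z₁) ∩ {b̄₀ ∉ C̃₀}) · P^{b̲₀}(F₁(b₀,t₁,z₁,x))`
  (`J(b₀) = p𝟙{b₀ is a bond}` is the factor `p^N`, `N = 1`), from the level-`1` bound (4.63)
  (`nobleKerXi_le_tsum_eventFN`) and the level-`0` bound (`measure_nobleCell_inter_le_tsum_eventF0'`, which keeps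
  the factor `{b̄₀ ∉ C̃₀}`); the term `z₁ = b̲₀` vanishes because `F₁(b₀,t₁,b̲₀,x) = ∅` (`b̲₀ ∉ {t₁,z₁,x}`).

The levels `1 ≤ i ≤ N-1` of (4.65) for `N ≥ 2` (events `F = F′ ∪ F″ ∪ F‴`, module `NobleBoundingEventsF`) are not
assembled here.  Nothing in this module is a cited hypothesis.
-/

noncomputable section

namespace Literature.Probability.FitznerVanDerHofstad2017

open _root_.MeasureTheory Literature.Barriers.CriticalPhenomena Literature.Probability.Percolation
open Literature.Probability.LatticeModels _root_.SimpleGraph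
open scoped ENNReal

variable {d : ℕ}

/-- A `tsum` of indicators at a fixed point is the indicator of the `tsum`. [folklore] -/
theorem tsum_setIndicator_apply {ι : Type*} (A : Set (Site d)) (f : ι → Site d → ℝ≥0∞) (z : Site d) :
    ∑' i, A.indicator (f i) z = A.indicator (fun z => ∑' i, f i z) z := by
  by_cases hz : z ∈ A
  · simp only [Set.indicator_of_mem hz]
  · simp only [Set.indicator_of_notMem hz, tsum_zero]

/-- `F_N((u,v),t,u,x) = ∅`: the constraint `b̲_{N-1} ∉ {t_N,z_N,y}` excludes `z_N = b̲_{N-1}`.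
[cite: FitznerVanDerHofstad2017, (4.58) (arXiv:1506.07977v2 p. 41; EJP 22 (2017) no. 43 p. 38)] -/
theorem eventFN_self_eq_empty (u v t x : Site d) : eventFN u v t u x = ∅ := by
  ext ω
  simp only [eventFN, Set.mem_inter_iff, Set.mem_setOf_eq, Set.mem_insert_iff, Set.mem_singleton_iff,
    true_or, or_true, not_true_eq_false, and_false, Set.mem_empty_iff_false]

/-- `P^B(∅) = 0`. [folklore] -/
theorem probOff_empty_event (p : unitInterval) (B : Set (Sym2 (Site d))) :
    probOff d p B (∅ : Set (BondConfig (Site d))) = 0 := by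
  have h : occursOff B (∅ : Set (BondConfig (Site d))) = ∅ :=
    Set.eq_empty_iff_forall_notMem.2 fun ω hω => (mem_occursOff_iff B ∅ ω).1 hω
  rw [probOff_def, h, measure_empty]

/-! ### The one-level engine -/

/-- **One level of (4.65) (Tonelli step).**  If the inner kernel satisfies, for every bond `b = (u,v′)` with
`u ≠ v′` and every set `A″`, `h(u)(A″,v′,x) ≤ Σ_z 𝟙_{A″}(z) · G(b,z)` with `G` independent of `A″`, then
`(𝒩^{B,A′} h)(A,v,x) ≤ Σ_b Σ_z J(b) · P_p(nobleCell^{B,A′}(A,v,b) ∩ {z ∈ C̃^{b}(v)(ω_{Bᶜ}) ∪ A′}) · G(b,z)`: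
the indicator `𝟙{z ∈ C̃}` produced by the bound of the next level is pulled into the expectation of this level
("The probabilities in (4.65) factor as the events … occur on different percolation configurations").
[cite: FitznerVanDerHofstad2017, (4.63)–(4.65) (arXiv:1506.07977v2 pp. 42–43; EJP 22 (2017) no. 43 pp. 39–40)] -/
theorem nobleOp_le_tsum_of_kernel_le (p : unitInterval) (B : Set (Sym2 (Site d))) (A' : Set (Site d))
    (h : NobleKernel d) (A : Set (Site d)) (v x : Site d) (G : Site d × Site d → Site d → ℝ≥0∞)
    (hh : ∀ b : Site d × Site d, b.1 ≠ b.2 → ∀ A'' : Set (Site d),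
      h b.1 A'' b.2 x ≤ ∑' z : Site d, A''.indicator (G b) z) :
    nobleOp d p B A' h A v x ≤ ∑' b : Site d × Site d, ∑' z : Site d, ENNReal.ofReal (bondJ d p (b.2 - b.1)) *
      (bondPercolation (zdGraph d) p
          (nobleCell B A' A v b.1 b.2 ∩ {ω | z ∈ restrCluster b.1 b.2 v (offBonds B ω) ∪ A'}) * G b z) := by
  classical
  rw [nobleOp_apply]
  refine ENNReal.tsum_le_tsum fun b => ?_
  rw [ENNReal.tsum_mul_left]
  by_cases hb : b.1 = b.2
  · have hJ : bondJ d p (b.2 - b.1) = 0 := by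
      rw [hb, sub_self, bondJ_def, if_neg (SimpleGraph.irrefl _)]
    rw [hJ, ENNReal.ofReal_zero, zero_mul, zero_mul]
  refine mul_le_mul' le_rfl ?_
  set S : Site d → Set (BondConfig (Site d)) := fun z =>
    nobleCell B A' A v b.1 b.2 ∩ {ω | z ∈ restrCluster b.1 b.2 v (offBonds B ω) ∪ A'} with hS
  have hSm : ∀ z, MeasurableSet (S z) := fun z =>
    (measurableSet_nobleCell B A' A v b.1 b.2).inter
      (measurableSet_setOf.2 (measurable_set_iff.1 (measurable_restrCluster_offBonds B A' b.1 b.2 v) z))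
  calc ∫⁻ ω, (nobleCell B A' A v b.1 b.2).indicator
          (fun ω => h b.1 (restrCluster b.1 b.2 v (offBonds B ω) ∪ A') b.2 x) ω ∂(bondPercolation (zdGraph d) p)
      ≤ ∫⁻ ω, ∑' z : Site d, (S z).indicator (fun _ => G b z) ω ∂(bondPercolation (zdGraph d) p) := by
        refine lintegral_mono fun ω => ?_
        by_cases hω : ω ∈ nobleCell B A' A v b.1 b.2
        · rw [Set.indicator_of_mem hω]
          refine (hh b hb _).trans (le_of_eq (tsum_congr fun z => ?_))
          by_cases hz : z ∈ restrCluster b.1 b.2 v (offBonds B ω) ∪ A'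
          · rw [Set.indicator_of_mem hz, Set.indicator_of_mem (show ω ∈ S z from ⟨hω, hz⟩)]
          · rw [Set.indicator_of_notMem hz, Set.indicator_of_notMem (show ω ∉ S z from fun h => hz h.2)]
        · rw [Set.indicator_of_notMem hω]
          exact zero_le
    _ = ∑' z : Site d, ∫⁻ ω, (S z).indicator (fun _ => G b z) ω ∂(bondPercolation (zdGraph d) p) :=
        lintegral_tsum fun z => (measurable_const.indicator (hSm z)).aemeasurable
    _ = ∑' z : Site d, bondPercolation (zdGraph d) p (S z) * G b z := by
        refine tsum_congr fun z => ?_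
        rw [lintegral_indicator_const (hSm z), mul_comm]

/-! ### Level `0` with the factor `{b̄₀ ∉ C̃₀}` kept -/

/-- **Level `0` under `P_p`, with `{b̄₀ ∉ C̃₀}` kept** (refines `measure_nobleCell_inter_le_tsum_eventF0`): for
`z ≠ y`, `P_p(nobleCell ∅ ∅ {0} 0 y y' ∩ {z ∈ C̃₀}) ≤ Σ_w P_p(F₀((y,y'),w,z) ∩ {y' ∉ C̃^{(y,y')}(0)})`.
[cite: FitznerVanDerHofstad2017, (4.57) and (4.65) (arXiv:1506.07977v2 pp. 41, 43; EJP 22 (2017) no. 43 pp. 38, 40)] -/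
theorem measure_nobleCell_inter_le_tsum_eventF0' (p : unitInterval) {y y' z : Site d} (hzy : z ≠ y) :
    bondPercolation (zdGraph d) p (nobleCell ∅ ∅ {0} 0 y y' ∩ {ω | z ∈ restrCluster y y' 0 (offBonds ∅ ω) ∪ ∅}) ≤
      ∑' w : Site d, bondPercolation (zdGraph d) p (eventF0 y y' w z ∩ {ω | y' ∉ restrCluster y y' 0 ω}) := by
  have hsub : nobleCell ∅ ∅ {0} 0 y y' ∩ {ω | z ∈ restrCluster y y' 0 (offBonds ∅ ω) ∪ ∅} ⊆
      (⋃ w : Site d, (eventF0 y y' w z ∩ {ω | y' ∉ restrCluster y y' 0 ω})) ∪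
        {ω | ¬ ω ⊆ (zdGraph d).edgeSet} := by
    rintro ω ⟨hcell, hz⟩
    by_cases hl : ω ⊆ (zdGraph d).edgeSet
    · left
      have hcell' := hcell
      rw [mem_nobleCell_iff, offBonds_empty, Set.union_empty] at hcell'
      obtain ⟨w, hw⟩ := Set.mem_iUnion.1 (nobleCell_inter_subset_iUnion_eventF0 hzy ⟨⟨hcell, hz⟩, hl⟩)
      exact Set.mem_iUnion.2 ⟨w, hw, hcell'.2⟩
    · exact Or.inr hl
  calc bondPercolation (zdGraph d) p (nobleCell ∅ ∅ {0} 0 y y' ∩ {ω | z ∈ restrCluster y y' 0 (offBonds ∅ ω) ∪ ∅})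
      ≤ bondPercolation (zdGraph d) p
          ((⋃ w : Site d, (eventF0 y y' w z ∩ {ω | y' ∉ restrCluster y y' 0 ω})) ∪
            {ω | ¬ ω ⊆ (zdGraph d).edgeSet}) := measure_mono hsub
    _ ≤ bondPercolation (zdGraph d) p (⋃ w : Site d, (eventF0 y y' w z ∩ {ω | y' ∉ restrCluster y y' 0 ω})) +
          bondPercolation (zdGraph d) p {ω | ¬ ω ⊆ (zdGraph d).edgeSet} := measure_union_le _ _
    _ = bondPercolation (zdGraph d) p (⋃ w : Site d, (eventF0 y y' w z ∩ {ω | y' ∉ restrCluster y y' 0 ω})) := by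
        rw [measure_not_subset_edgeSet, add_zero]
    _ ≤ ∑' w : Site d, bondPercolation (zdGraph d) p (eventF0 y y' w z ∩ {ω | y' ∉ restrCluster y y' 0 ω}) :=
        measure_iUnion_le _

/-! ### (4.65) for `N = 1` -/

/-- **(4.65), `N = 1`.**  `Ξ^{(1)}_p(x) ≤ Σ_{b₀} Σ_{z₁,t₁,w₀} J(b₀) · P_p(F₀(b₀,w₀,z₁) ∩ {b̄₀ ∉ C̃₀}) ·
P^{b̲₀}_p(F₁(b₀,t₁,z₁,x))` with `b₀ = (b̲₀, b̄₀) = (b.1, b.2)`, `C̃₀ = C̃^{b₀}(0)`, `J(b₀) = p𝟙{b₀ is a bond}`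
(the factor `p^N`, `N = 1`); the two probabilities refer to the two independent levels `0` and `1` of
`Ξ^{(1)} = 𝒩^{∅,∅}(nobleKerXi)({0},0,x)`.
[cite: FitznerVanDerHofstad2017, (4.65) with (4.57), (4.58), (4.63) (arXiv:1506.07977v2 pp. 41–43; EJP 22 (2017) no. 43 pp. 38–40)] -/
theorem nobleXiT_one_le (p : unitInterval) (x : Site d) :
    nobleXiT d p 1 x ≤ ∑' b : Site d × Site d, ∑' z : Site d, ∑' t : Site d, ∑' w : Site d,
      ENNReal.ofReal (bondJ d p (b.2 - b.1)) *
        (bondPercolation (zdGraph d) p (eventF0 b.1 b.2 w z ∩ {ω | b.2 ∉ restrCluster b.1 b.2 0 ω}) *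
          probOff d p (bondsAt {b.1}) (eventFN b.1 b.2 t z x)) := by
  classical
  have h1 : nobleXiT d p 1 x = nobleOp d p ∅ ∅ (nobleKerXi d p) {0} 0 x := by
    rw [nobleXiT, if_neg (fun h => one_ne_zero h.1), nobleXiBT_succ, nobleIter_zero]
  rw [h1]
  set G : Site d × Site d → Site d → ℝ≥0∞ := fun b z =>
    ∑' t : Site d, probOff d p (bondsAt {b.1}) (eventFN b.1 b.2 t z x) with hG
  have hh : ∀ b : Site d × Site d, b.1 ≠ b.2 → ∀ A'' : Set (Site d),
      nobleKerXi d p b.1 A'' b.2 x ≤ ∑' z : Site d, A''.indicator (G b) z := by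
    intro b hb A''
    refine (nobleKerXi_le_tsum_eventFN p hb).trans (le_of_eq (tsum_congr fun z => ?_))
    exact tsum_setIndicator_apply A'' (fun t z => probOff d p (bondsAt {b.1}) (eventFN b.1 b.2 t z x)) z
  refine (nobleOp_le_tsum_of_kernel_le p ∅ ∅ (nobleKerXi d p) {0} 0 x G hh).trans ?_
  refine ENNReal.tsum_le_tsum fun b => ENNReal.tsum_le_tsum fun z => ?_
  simp_rw [ENNReal.tsum_mul_left]
  refine mul_le_mul' le_rfl ?_
  by_cases hz : z = b.1
  · have hG0 : G b z = 0 := by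
      rw [hG]
      simp only [hz, eventFN_self_eq_empty, probOff_empty_event, tsum_zero]
    rw [hG0, mul_zero]
    exact zero_le
  · rw [hG, ← ENNReal.tsum_mul_left]
    refine ENNReal.tsum_le_tsum fun t => ?_
    rw [ENNReal.tsum_mul_right]
    exact mul_le_mul' (measure_nobleCell_inter_le_tsum_eventF0' p hz) le_rfl

end Literature.Probability.FitznerVanDerHofstad2017
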